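import Literature.NumberTheory.EllipticCurves.ComplexMultiplicationSingularModuliRows
import Literature.NumberTheory.EllipticCurves.OrdinaryPrimesProofs
import HarnessLib

/-!
# Coates–Wiles (1977), Theorem 1: the non-anomalous split primes without Deuring's theorem

Topic `NumberTheory/EllipticCurves`; proof sibling of
`Literature/NumberTheory/EllipticCurves/ComplexMultiplicationCoatesWiles.lean`, serving the named
fact `Literature.NumberTheory.EllipticCurves.CoatesWiles1977_L_one_eq_zero_of_not_isOfFinAddOrder` (Coates–Wiles, Invent. Math. 39
(1977), Thm. 1 for `F = ℚ`: a rational point of infinite order on `E/ℚ` with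
`j(E) ∈ maximalCMJInvariants` forces `L(E/ℚ, 1) = 0`; `ComplexMultiplication.lean`).

The tree reduces that fact to three named facts
(`CoatesWiles1977_L_one_eq_zero_of_not_isOfFinAddOrder_of_facts`):

1. `CoatesWiles1977_L_one_div_period_mem_prime` — the per-prime divisibility `𝔭 ∣ Ω⁻¹L(E/ℚ,1)`
   forced by a point of infinite order, for every good prime `p > 7` which splits in `K` and is
   not anomalous (Coates–Wiles §6 p. 250: Lemma 35, Thm. 34, (49), Cor. 32, Thm. 29);
2. `Deuring1941_frobeniusTrace_eq_add_conj` — Deuring's `a_p = π + π̄` at split primes;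
3. `exists_isCMPeriod_of_j_mem_maximalCMJInvariants` — the period lattice is `Ω𝓞_K`
   (reduced in `ComplexMultiplicationSingularModuli.lean` to the table of singular moduli
   `singularModuli_classNumberOne`, of which the rows `d = -3, -4` are proved).

In the printed proof (p. 250, l. −4 to p. 251, l. 2) fact 2 enters only through p. 232: *"there
always exist infinitely many primes `p` which split in `K`, but which are not anomalous for `E`.
As we shall see at the end of the paper, this is what is important for the proof of Theorem 1"* —
Coates–Wiles get them from `a_p = π + π̄`, `4p = u² + |d|x²` and Dirichlet's theorem.  **This file
removes fact 2 from the reduction** by producing those primes elementarily, for *every* elliptic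
curve over `ℚ` and every `d ≠ 0`:

* `infinite_setOf_prime_isSquare_frobeniusTrace_ne_one` (proved): for a globally minimal `W/ℚ`
  and `d ≠ 0` there are infinitely many primes `p > 7` of good reduction with `p ∤ d`, `d` a
  square mod `p` and `a_p(W) ≠ 1`.  Proof: by the "poor man's Chebotarev theorem"
  `Literature.NumberTheory.Sieve.exists_prime_gt_map_int_splits_holds` (an elementary consequence of Schur's 1912 theorem on
  prime divisors of polynomials, `Literature/NumberTheory/Sieve/PrimeDivisorsOfPolynomials.lean`)
  applied to `c · (X² − d)`, `c = 4X³ + b₂X² + 2b₄X + b₆` the 2-torsion cubic of the integral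
  model, there are arbitrarily large primes `p` modulo which both factors split into linear
  factors; then `d` is a square mod `p`, and the reduction `Ẽ/𝔽_p` has all its `2`-torsion
  rational, so `4 ∣ N_p = #Ẽ(𝔽_p)` (`WeierstrassCurve.four_dvd_natCard_point_of_splits`,
  `OrdinaryPrimesProofs.lean`) and `a_p = p + 1 − N_p` is even, in particular `≠ 1`.  (This is the
  mechanism of Coates–Wiles' own Lemma 12, second sentence — "if `2` ramifies or splits in `K`,
  then anomalous primes do not exist for `E`", i.e. a rational `2`-torsion point makes `a_p` even —
  run at the primes where the whole `2`-torsion becomes rational.)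
* `entireLFunction_one_eq_zero_of_isGloballyMinimal_of_mem_prime`,
  `CoatesWiles1977_L_one_eq_zero_of_not_isOfFinAddOrder_of_mem_prime` (proved): Theorem 1
  (`F = ℚ`) from facts 1 and 3 only, assembled exactly as on pp. 250–251
  (`eq_zero_of_infinite_setOf_mem_prime`: an element of `K` divisible by infinitely many `𝔭` is
  `0`), including the passage to a global minimal model;
* `CoatesWiles1977_L_one_eq_zero_of_not_isOfFinAddOrder_of_mem_prime_of_singularModuli`,
  `finite_point_of_j_mem_maximalCMJInvariants_of_L_one_ne_zero_of_mem_prime_of_singularModuli`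
  (proved): Theorem 1 and bsd.S28 (Mordell–Weil part, maximal-order CM) from fact 1 and the table
  of singular moduli;
* `entireLFunction_one_eq_zero_of_j_eq_zero_of_mem_prime`,
  `entireLFunction_one_eq_zero_of_j_eq_1728_of_mem_prime` (proved): for `j = 0` (the curves
  `y² = x³ + D`) and `j = 1728` (the curves `y² = x³ − Dx` of Coates–Wiles' introduction, p. 223,
  including the congruent number curves) Theorem 1 follows from fact 1 **alone**, the rows
  `d = −3, −4` of the singular-moduli table being proved (`exists_isCMPeriod_of_j_eq_zero`,
  `exists_isCMPeriod_of_j_eq_1728`).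

* (added after `ComplexMultiplicationSingularModuliRows.lean` proved the rows
  `d = −7, −8, −11, −19` and isolated `d = −43, −67, −163` as the named fact
  `singularModuli_classNumberOne_three`) `j_cmPeriodPair_cmDiscr_eq_of_mem_six` (the six proved
  rows packaged), `entireLFunction_one_eq_zero_of_j_cmPeriodPair_eq_of_mem_prime` (Theorem 1 from
  fact 1 for any curve whose row of the table is known),
  `entireLFunction_one_eq_zero_of_j_mem_six_of_mem_prime` (**Theorem 1 from fact 1 alone for the
  six CM `j`-invariants `0, 1728, −3375, 8000, −32768, −884736`**, all models over `ℚ`),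
  `CoatesWiles1977_L_one_eq_zero_of_not_isOfFinAddOrder_of_mem_prime_of_three` and
  `finite_point_of_j_mem_maximalCMJInvariants_of_L_one_ne_zero_of_mem_prime_of_three` (**the
  target fact and bsd.S28 from fact 1 and the three remaining rows**; the latter supersedes
  `finite_point_of_j_mem_maximalCMJInvariants_of_L_one_ne_zero_of_three`, which also assumed
  Deuring's `a_p = π + π̄`) — all proved.

After this file the trust base of `CoatesWiles1977_L_one_eq_zero_of_not_isOfFinAddOrder` is
exactly fact 1 (the `𝔭`-adic core of the paper, §§2–6: Grössencharacter, Lubin–Tate towers,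
elliptic units, local and global class field theory) and `singularModuli_classNumberOne_three`
(the singular moduli `j(𝓞_K)` for `d_K = −43, −67, −163`; Cox, *Primes of the form x² + ny²*,
§12.C table (12.20)).

## References

* J. Coates, A. Wiles, *On the conjecture of Birch and Swinnerton-Dyer*, Invent. Math. 39 (1977),
  223–251: Thm. 1 (p. 223), Lemma 12 and p. 232, §6 pp. 250–251. [CoatesWiles1977]
* I. Schur, *Über die Existenz unendlich vieler Primzahlen in einigen speziellen arithmetischen
  Progressionen*, Sitzungsber. Berliner Math. Ges. 11 (1912), 40–50. [Schur1912]
* J. H. Silverman, *The Arithmetic of Elliptic Curves*, GTM 106, 2nd ed. (2009), III.2.3 and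
  Exercise 3.7 (the `2`-torsion points `(x, −(a₁x + a₃)/2)`). [SilvermanAEC2009]
* D. A. Cox, *Primes of the form x² + ny²*, 2nd ed., Wiley (2013), §12.C table (12.20)
  (singular moduli of class number one). [Cox2013]
-/

noncomputable section

open scoped Classical
open Polynomial WeierstrassCurve Complex

namespace Literature.NumberTheory.EllipticCurves

/-! ### Infinitely many good split primes with `a_p ≠ 1`, elementarily -/

/-- **Non-anomalous split primes, for every elliptic curve over `ℚ`.**  Let `W/ℚ` be a globally
minimal Weierstrass equation of an elliptic curve and `d ≠ 0` an integer.  Then there are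
infinitely many primes `p > 7` with `p ∤ Δ_min(W)` (good reduction), `p ∤ d`, `d` a square modulo
`p`, and `a_p(W) ≠ 1`.  Indeed, by the poor man's Chebotarev theorem
(`Literature.NumberTheory.Sieve.exists_prime_gt_map_int_splits_holds`, from Schur 1912) the integer polynomial
`(4X³ + b₂X² + 2b₄X + b₆)·(X² − d)` splits into linear factors modulo arbitrarily large primes `p`;
for such `p` the reduction `Ẽ/𝔽_p` has its three points of order `2` rational, so
`4 ∣ #Ẽ(𝔽_p) = N_p` (`WeierstrassCurve.four_dvd_natCard_point_of_splits`) and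
`a_p = p + 1 − N_p` is even.  For `d = d_K` this supplies the primes "which split in `K`, but
which are not anomalous for `E`" of Coates–Wiles (1977), p. 232 and Lemma 12, without Deuring's
`a_p = π + π̄`. [cite: CoatesWiles1977, Lemma 12 and p. 232] -/
theorem infinite_setOf_prime_isSquare_frobeniusTrace_ne_one (W : WeierstrassCurve ℚ)
    [W.IsElliptic] [W.IsGloballyMinimal] {d : ℤ} (hd : d ≠ 0) :
    {p : ℕ | p.Prime ∧ 7 < p ∧ ¬ (p : ℤ) ∣ minimalDiscriminantInt W ∧ ¬ (p : ℤ) ∣ d ∧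
      IsSquare ((d : ℤ) : ZMod p) ∧ W.frobeniusTrace p ≠ 1}.Infinite := by
  apply Set.infinite_of_forall_exists_gt
  intro N
  set M : WeierstrassCurve ℤ := integralModelInt W with hM
  have hΔ0 : M.Δ ≠ 0 := minimalDiscriminantInt_ne_zero W
  -- the polynomial `c · (X² - d)`
  set c : ℤ[X] := M.twoTorsionPolynomial.toPoly with hc
  have hc0 : c ≠ 0 := Cubic.ne_zero_of_a_ne_zero (by norm_num [twoTorsionPolynomial])
  have hq0 : (X ^ 2 - Polynomial.C d : ℤ[X]) ≠ 0 := X_pow_sub_C_ne_zero two_pos d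
  have hF0 : c * (X ^ 2 - Polynomial.C d) ≠ 0 := mul_ne_zero hc0 hq0
  obtain ⟨p, hp, hNp, hsplit⟩ := Literature.NumberTheory.Sieve.exists_prime_gt_map_int_splits_holds
    (c * (X ^ 2 - Polynomial.C d)) hF0 (N + 7 + M.Δ.natAbs + d.natAbs)
  haveI := Fact.mk hp
  -- `p ∤ Δ_M` and `p ∤ d` since `p` is large
  have hpΔ : ¬ (p : ℤ) ∣ M.Δ := fun h => by
    have := Nat.le_of_dvd (Int.natAbs_pos.mpr hΔ0) (Int.ofNat_dvd_left.mp h)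
    omega
  have hpd : ¬ (p : ℤ) ∣ d := fun h => by
    have := Nat.le_of_dvd (Int.natAbs_pos.mpr hd) (Int.ofNat_dvd_left.mp h)
    omega
  have hp2 : (2 : ZMod p) ≠ 0 := by
    intro h
    have : ((2 : ℕ) : ZMod p) = 0 := by exact_mod_cast h
    rw [ZMod.natCast_eq_zero_iff] at this
    have := Nat.le_of_dvd two_pos this
    omega
  have hpΔ' : ((M.Δ : ℤ) : ZMod p) ≠ 0 := fun h => by
    rw [ZMod.intCast_zmod_eq_zero_iff_dvd] at h
    exact hpΔ h
  -- the two factors split modulo `p`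
  rw [Polynomial.map_mul] at hsplit
  have hX : ((X ^ 2 - Polynomial.C d : ℤ[X]).map (Int.castRingHom (ZMod p))) =
      X ^ 2 - Polynomial.C ((d : ℤ) : ZMod p) := by
    simp
  have hcp0 : c.map (Int.castRingHom (ZMod p)) ≠ 0 := by
    intro h
    have := congrArg (fun q => q.coeff 3) h
    simp only [hc, coeff_map, Cubic.coeff_eq_a, twoTorsionPolynomial, coeff_zero,
      eq_intCast] at this
    apply hp2
    have h4 : ((4 : ℤ) : ZMod p) = 2 * 2 := by push_cast; norm_num
    rw [h4] at this
    exact (mul_eq_zero.mp this).elim id id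
  have hX0 : ((X ^ 2 - Polynomial.C d : ℤ[X]).map (Int.castRingHom (ZMod p))) ≠ 0 := by
    rw [hX]; exact X_pow_sub_C_ne_zero two_pos _
  have hne : c.map (Int.castRingHom (ZMod p)) *
      (X ^ 2 - Polynomial.C d : ℤ[X]).map (Int.castRingHom (ZMod p)) ≠ 0 := mul_ne_zero hcp0 hX0
  have hcs : (c.map (Int.castRingHom (ZMod p))).Splits :=
    Splits.of_dvd hsplit hne (dvd_mul_right _ _)
  have hXs : ((X ^ 2 - Polynomial.C d : ℤ[X]).map (Int.castRingHom (ZMod p))).Splits :=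
    Splits.of_dvd hsplit hne (dvd_mul_left _ _)
  -- `d` is a square modulo `p`
  have hsq : IsSquare ((d : ℤ) : ZMod p) := by
    rw [hX] at hXs
    obtain ⟨i, hi⟩ := hXs.exists_eval_eq_zero (by
      rw [degree_X_pow_sub_C two_pos]; decide)
    simp only [eval_sub, eval_pow, eval_X, eval_C] at hi
    exact ⟨i, by linear_combination -hi⟩
  -- the reduced curve is elliptic and its 2-torsion cubic splits: `4 ∣ N_p`
  set E : WeierstrassCurve (ZMod p) := M.map (Int.castRingHom (ZMod p)) with hE
  haveI : E.IsElliptic := by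
    rw [isElliptic_iff, hE, map_Δ, isUnit_iff_ne_zero, eq_intCast]
    exact hpΔ'
  have hEs : E.twoTorsionPolynomial.toPoly.Splits := by
    rw [hE, map_twoTorsionPolynomial, Cubic.map_toPoly, ← hc]
    exact hcs
  have h4N : 4 ∣ Nat.card E.toAffine.Point := four_dvd_natCard_point_of_splits E hp2 hEs
  have hN : reductionPointCount W p = Nat.card E.toAffine.Point := rfl
  -- hence `a_p ≠ 1`
  have hna : W.frobeniusTrace p ≠ 1 := by
    intro h
    rw [frobeniusTrace, hN] at h
    have h' : (Nat.card E.toAffine.Point : ℤ) = p := by linarith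
    have h'' : Nat.card E.toAffine.Point = p := by exact_mod_cast h'
    rw [h''] at h4N
    rcases (Nat.dvd_prime hp).mp h4N with h4 | h4 <;> omega
  exact ⟨p, ⟨hp, by omega, hpΔ, hpd, hsq, hna⟩, by omega⟩

/-! ### Theorem 1 (`F = ℚ`) from the `𝔭`-divisibility fact and a CM period -/

/-- **Coates–Wiles, Theorem 1 for a globally minimal model, from the `𝔭`-divisibility fact and a
CM period** (Invent. Math. 39 (1977), §6 pp. 250–251, assembled as printed, with the split
non-anomalous primes of p. 232 supplied by `infinite_setOf_prime_isSquare_frobeniusTrace_ne_one`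
instead of Deuring's `a_p = π + π̄`): given `CoatesWiles1977_L_one_div_period_mem_prime` (`h1`)
and an `𝓞_K`-generator `Ω` of the period lattice, a rational point of infinite order forces
`L(E/ℚ, 1) = 0` — for each of the infinitely many primes `p > 7` of good reduction which split in
`K` and have `a_p ≠ 1`, `𝔭 ∣ Ω⁻¹L(E/ℚ,1)` (`h1`), hence `Ω⁻¹L(E/ℚ,1) = 0` (p. 251,
`eq_zero_of_infinite_setOf_mem_prime`). [cite: CoatesWiles1977, Thm 1 (proof, §6 pp. 250–251)] -/
theorem entireLFunction_one_eq_zero_of_isGloballyMinimal_of_mem_prime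
    (h1 : CoatesWiles1977_L_one_div_period_mem_prime)
    (W : WeierstrassCurve ℚ) [W.IsElliptic] [W.IsGloballyMinimal]
    (hj : W.j ∈ maximalCMJInvariants) {Ω : ℂ} (hΩ : IsCMPeriod W Ω)
    (P : W.toAffine.Point) (hP : ¬ IsOfFinAddOrder P) :
    W.entireLFunction 1 = 0 := by
  obtain ⟨hdneg, c, hc⟩ := neg_and_exists_of_mem_cmDiscrs (cmDiscr_mem_cmDiscrs hj)
  refine eq_zero_of_infinite_setOf_mem_prime (Ω := Ω) hdneg.le hc
    (infinite_setOf_prime_isSquare_frobeniusTrace_ne_one W hdneg.ne) ?_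
  rintro p ⟨hp, h7, hpΔ, hpd, hsq, hna⟩
  obtain ⟨𝔭, h𝔭, hp𝔭⟩ :=
    exists_ideal_isPrime_natCast_mem (d := cmDiscr W.j) hdneg.le hc hp.one_lt
  obtain ⟨a, b, ha, hb, hab⟩ := h1 W hj Ω hΩ P hP p hp h7 hpΔ hpd hsq hna 𝔭 h𝔭 hp𝔭
  exact ⟨hp, 𝔭, h𝔭, hp𝔭, a, b, ha, hb, hab⟩

/-- **Coates–Wiles 1977, Theorem 1 (`F = ℚ`), reduced to two named facts.** The printed form
`CoatesWiles1977_L_one_eq_zero_of_not_isOfFinAddOrder` (a rational point of infinite order on a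
curve with `j ∈ maximalCMJInvariants` forces `L(E/ℚ,1) = 0`) follows sorry-free from (`h1`) the
`𝔭`-divisibility of `Ω⁻¹L(E/ℚ,1)` (Coates–Wiles §6 p. 250: Thm. 29, Cor. 32, Thm. 34, Lemma 35) and
(`h3`) the existence of an `𝓞_K`-generator of the period lattice (Coates–Wiles §1 p. 225);
everything else — the passage to a global minimal model (`hasGlobalMinimalModel_rat_holds`,
`entireLFunction_smul`, `VariableChange.pointEquiv`), infinitely many split non-anomalous primes
(p. 232, here `infinite_setOf_prime_isSquare_frobeniusTrace_ne_one`) and the closing argument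
(p. 251) — is proved.  Supersedes `CoatesWiles1977_L_one_eq_zero_of_not_isOfFinAddOrder_of_facts`
(which also assumed Deuring's `a_p = π + π̄`). [cite: CoatesWiles1977, Thm 1 (p. 223)] -/
theorem CoatesWiles1977_L_one_eq_zero_of_not_isOfFinAddOrder_of_mem_prime
    (h1 : CoatesWiles1977_L_one_div_period_mem_prime)
    (h3 : exists_isCMPeriod_of_j_mem_maximalCMJInvariants) :
    CoatesWiles1977_L_one_eq_zero_of_not_isOfFinAddOrder := by
  intro W _ hj P hP
  obtain ⟨C, hC⟩ := hasGlobalMinimalModel_rat_holds W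
  have hjC : (C • W).j ∈ maximalCMJInvariants := by rwa [variableChange_j]
  have hP' : ¬ IsOfFinAddOrder (VariableChange.pointEquiv W C P) := by
    intro h
    apply hP
    have := (VariableChange.pointEquiv W C).symm.toAddMonoidHom.isOfFinAddOrder h
    rwa [AddEquiv.coe_toAddMonoidHom, AddEquiv.symm_apply_apply] at this
  obtain ⟨Ω, hΩ⟩ := h3 (C • W) hjC
  rw [← entireLFunction_smul W C]
  exact entireLFunction_one_eq_zero_of_isGloballyMinimal_of_mem_prime h1 (C • W) hjC hΩ _ hP'

/-- **Coates–Wiles 1977, Theorem 1 (`F = ℚ`) from the `𝔭`-divisibility fact and the table of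
singular moduli.**  `CoatesWiles1977_L_one_eq_zero_of_not_isOfFinAddOrder` follows from
`CoatesWiles1977_L_one_div_period_mem_prime` (`h1`, Coates–Wiles §6 p. 250) and
`singularModuli_classNumberOne` (`hS`, Cox, *Primes of the form x² + ny²*, table (12.20)), via
`exists_isCMPeriod_of_j_mem_maximalCMJInvariants_of_singularModuli`; Deuring's theorem is no
longer needed. [cite: CoatesWiles1977, Thm 1 (p. 223)] -/
theorem CoatesWiles1977_L_one_eq_zero_of_not_isOfFinAddOrder_of_mem_prime_of_singularModuli
    (h1 : CoatesWiles1977_L_one_div_period_mem_prime)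
    (hS : singularModuli_classNumberOne) :
    CoatesWiles1977_L_one_eq_zero_of_not_isOfFinAddOrder :=
  CoatesWiles1977_L_one_eq_zero_of_not_isOfFinAddOrder_of_mem_prime h1
    (exists_isCMPeriod_of_j_mem_maximalCMJInvariants_of_singularModuli hS)

/-- **bsd.S28 (Mordell–Weil part, maximal-order CM) from the `𝔭`-divisibility fact and the table
of singular moduli**: the target fact `finite_point_of_j_mem_maximalCMJInvariants_of_L_one_ne_zero`
(`L(E, 1) ≠ 0 ⇒ E(ℚ)` finite, for `j(E) ∈ maximalCMJInvariants`) follows from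
`CoatesWiles1977_L_one_div_period_mem_prime` and `singularModuli_classNumberOne` through the proved
Mordell–Weil reduction `finite_point_of_j_mem_maximalCMJInvariants_of_L_one_ne_zero_of_CoatesWiles1977`
(`ComplexMultiplicationProofs.lean`). [cite: CoatesWiles1977, Thm 1 (p. 223)] -/
theorem finite_point_of_j_mem_maximalCMJInvariants_of_L_one_ne_zero_of_mem_prime_of_singularModuli
    (h1 : CoatesWiles1977_L_one_div_period_mem_prime)
    (hS : singularModuli_classNumberOne) :
    finite_point_of_j_mem_maximalCMJInvariants_of_L_one_ne_zero :=
  finite_point_of_j_mem_maximalCMJInvariants_of_L_one_ne_zero_of_CoatesWiles1977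
    (CoatesWiles1977_L_one_eq_zero_of_not_isOfFinAddOrder_of_mem_prime_of_singularModuli h1 hS)

/-! ### The cases `j = 0` and `j = 1728` from the `𝔭`-divisibility fact alone -/

/-- **Coates–Wiles, Theorem 1 for `j = 0`** (the curves `y² = x³ + D`, CM by `ℤ[ρ]`), from the
`𝔭`-divisibility fact `CoatesWiles1977_L_one_div_period_mem_prime` alone: the CM period exists
unconditionally (`exists_isCMPeriod_of_j_eq_zero`, row `d = −3` of the singular moduli being
proved).  A rational point of infinite order forces `L(E/ℚ, 1) = 0`.
[cite: CoatesWiles1977, Thm 1 (p. 223)] -/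
theorem entireLFunction_one_eq_zero_of_j_eq_zero_of_mem_prime
    (h1 : CoatesWiles1977_L_one_div_period_mem_prime)
    (W : WeierstrassCurve ℚ) [W.IsElliptic] (hj : W.j = 0)
    (P : W.toAffine.Point) (hP : ¬ IsOfFinAddOrder P) :
    W.entireLFunction 1 = 0 := by
  obtain ⟨C, hC⟩ := hasGlobalMinimalModel_rat_holds W
  have hjC0 : (C • W).j = 0 := by rw [variableChange_j, hj]
  have hjC : (C • W).j ∈ maximalCMJInvariants := by
    rw [hjC0]; simp [maximalCMJInvariants]
  have hP' : ¬ IsOfFinAddOrder (VariableChange.pointEquiv W C P) := by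
    intro h
    apply hP
    have := (VariableChange.pointEquiv W C).symm.toAddMonoidHom.isOfFinAddOrder h
    rwa [AddEquiv.coe_toAddMonoidHom, AddEquiv.symm_apply_apply] at this
  obtain ⟨Ω, hΩ⟩ := exists_isCMPeriod_of_j_eq_zero (C • W) hjC0
  rw [← entireLFunction_smul W C]
  exact entireLFunction_one_eq_zero_of_isGloballyMinimal_of_mem_prime h1 (C • W) hjC hΩ _ hP'

/-- **Coates–Wiles, Theorem 1 for `j = 1728`** (the curves `y² = x³ − Dx` of the introduction of
Coates–Wiles, p. 223 — "In particular, the theorem applies to the curves `y² = x³ − Dx`, `D` a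
non-zero rational number, which were originally studied by Birch and Swinnerton-Dyer" —, CM by
`ℤ[i]`), from the `𝔭`-divisibility fact `CoatesWiles1977_L_one_div_period_mem_prime` alone: the CM
period exists unconditionally (`exists_isCMPeriod_of_j_eq_1728`, row `d = −4` proved).  A rational
point of infinite order forces `L(E/ℚ, 1) = 0`. [cite: CoatesWiles1977, Thm 1 (p. 223)] -/
theorem entireLFunction_one_eq_zero_of_j_eq_1728_of_mem_prime
    (h1 : CoatesWiles1977_L_one_div_period_mem_prime)
    (W : WeierstrassCurve ℚ) [W.IsElliptic] (hj : W.j = 1728)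
    (P : W.toAffine.Point) (hP : ¬ IsOfFinAddOrder P) :
    W.entireLFunction 1 = 0 := by
  obtain ⟨C, hC⟩ := hasGlobalMinimalModel_rat_holds W
  have hjC0 : (C • W).j = 1728 := by rw [variableChange_j, hj]
  have hjC : (C • W).j ∈ maximalCMJInvariants := by
    rw [hjC0]; simp [maximalCMJInvariants]
  have hP' : ¬ IsOfFinAddOrder (VariableChange.pointEquiv W C P) := by
    intro h
    apply hP
    have := (VariableChange.pointEquiv W C).symm.toAddMonoidHom.isOfFinAddOrder h
    rwa [AddEquiv.coe_toAddMonoidHom, AddEquiv.symm_apply_apply] at this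
  obtain ⟨Ω, hΩ⟩ := exists_isCMPeriod_of_j_eq_1728 (C • W) hjC0
  rw [← entireLFunction_smul W C]
  exact entireLFunction_one_eq_zero_of_isGloballyMinimal_of_mem_prime h1 (C • W) hjC hΩ _ hP'

/-! ### After the singular-moduli rows: six `j`-invariants from fact 1 alone,
the target from fact 1 and the three remaining rows -/

/-- **The six proved rows of the table of singular moduli**, in the form `j(Λ_{d(j)}) = j` used by
`singularModuli_classNumberOne`: `j = 0, 1728, -3375, 8000, -32768, -884736`
(`d_K = -3, -4, -7, -8, -11, -19`; `j_cmPeriodPair_neg_three/four/seven/eight/eleven/nineteen`).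
[cite: Cox2013, §12.C table (12.20)] -/
theorem j_cmPeriodPair_cmDiscr_eq_of_mem_six {j : ℚ}
    (hj : j ∈ ({0, 1728, -3375, 8000, -32768, -884736} : Finset ℚ)) :
    (cmPeriodPair (cmDiscr j)).j = (j : ℂ) := by
  simp only [Finset.mem_insert, Finset.mem_singleton] at hj
  rcases hj with rfl | rfl | rfl | rfl | rfl | rfl
  · rw [cmDiscr_zero, j_cmPeriodPair_neg_three]; norm_num
  · rw [cmDiscr_1728, j_cmPeriodPair_neg_four]; norm_num
  · rw [cmDiscr_neg_3375, j_cmPeriodPair_neg_seven]; norm_num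
  · rw [cmDiscr_8000, j_cmPeriodPair_neg_eight]; norm_num
  · rw [cmDiscr_neg_32768, j_cmPeriodPair_neg_eleven]; norm_num
  · rw [cmDiscr_neg_884736, j_cmPeriodPair_neg_nineteen]; norm_num

/-- **Coates–Wiles, Theorem 1 (`F = ℚ`) for a curve whose singular modulus is known**, from the
`𝔭`-divisibility fact `CoatesWiles1977_L_one_div_period_mem_prime` alone: if
`j(E) ∈ maximalCMJInvariants` and the row `j(Λ_{d(j(E))}) = j(E)` of Cox's table (12.20) holds,
then a rational point of infinite order forces `L(E/ℚ, 1) = 0`.  Proof: pass to a global minimal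
model `C • E` (`hasGlobalMinimalModel_rat_holds`; `j`, `L(E, s)` and the Mordell–Weil group are
invariant: `variableChange_j`, `entireLFunction_smul`, `VariableChange.pointEquiv`), obtain the CM
period `L = Ω𝓞_K` from the row (`exists_isCMPeriod_of_j_cmPeriodPair_eq`: uniformization and
Cox Thm. 10.9), and apply `entireLFunction_one_eq_zero_of_isGloballyMinimal_of_mem_prime`
(pp. 232, 250–251 of the paper, proved). [cite: CoatesWiles1977, Thm 1 (p. 223); §6 pp. 250–251] -/
theorem entireLFunction_one_eq_zero_of_j_cmPeriodPair_eq_of_mem_prime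
    (h1 : CoatesWiles1977_L_one_div_period_mem_prime)
    (W : WeierstrassCurve ℚ) [W.IsElliptic] (hj : W.j ∈ maximalCMJInvariants)
    (hJ : (cmPeriodPair (cmDiscr W.j)).j = (W.j : ℂ))
    (P : W.toAffine.Point) (hP : ¬ IsOfFinAddOrder P) :
    W.entireLFunction 1 = 0 := by
  obtain ⟨C, hC⟩ := hasGlobalMinimalModel_rat_holds W
  have hjC0 : (C • W).j = W.j := by rw [variableChange_j]
  have hjC : (C • W).j ∈ maximalCMJInvariants := by rwa [hjC0]
  have hP' : ¬ IsOfFinAddOrder (VariableChange.pointEquiv W C P) := by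
    intro h
    apply hP
    have := (VariableChange.pointEquiv W C).symm.toAddMonoidHom.isOfFinAddOrder h
    rwa [AddEquiv.coe_toAddMonoidHom, AddEquiv.symm_apply_apply] at this
  obtain ⟨Ω, hΩ⟩ := exists_isCMPeriod_of_j_cmPeriodPair_eq (C • W) hjC (by rw [hjC0]; exact hJ)
  rw [← entireLFunction_smul W C]
  exact entireLFunction_one_eq_zero_of_isGloballyMinimal_of_mem_prime h1 (C • W) hjC hΩ _ hP'

/-- **Coates–Wiles, Theorem 1 (`F = ℚ`) for the six CM `j`-invariants
`0, 1728, -3375, 8000, -32768, -884736`** (CM by `𝓞_K`, `d_K = -3, -4, -7, -8, -11, -19`; this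
covers every model over `ℚ`, in particular all twists), from the `𝔭`-divisibility fact
`CoatesWiles1977_L_one_div_period_mem_prime` **alone**, the corresponding rows of the table of
singular moduli being theorems: a rational point of infinite order forces `L(E/ℚ, 1) = 0`.
[cite: CoatesWiles1977, Thm 1 (p. 223)] -/
theorem entireLFunction_one_eq_zero_of_j_mem_six_of_mem_prime
    (h1 : CoatesWiles1977_L_one_div_period_mem_prime)
    (W : WeierstrassCurve ℚ) [W.IsElliptic]
    (hj : W.j ∈ ({0, 1728, -3375, 8000, -32768, -884736} : Finset ℚ))
    (P : W.toAffine.Point) (hP : ¬ IsOfFinAddOrder P) :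
    W.entireLFunction 1 = 0 := by
  refine entireLFunction_one_eq_zero_of_j_cmPeriodPair_eq_of_mem_prime h1 W ?_
    (j_cmPeriodPair_cmDiscr_eq_of_mem_six hj) P hP
  simp only [Finset.mem_insert, Finset.mem_singleton] at hj
  rcases hj with h | h | h | h | h | h <;> rw [h] <;> simp [maximalCMJInvariants]

/-- **Coates–Wiles 1977, Theorem 1 (`F = ℚ`) from the `𝔭`-divisibility fact and the three
remaining singular moduli.**  The named fact `CoatesWiles1977_L_one_eq_zero_of_not_isOfFinAddOrder`
follows from `CoatesWiles1977_L_one_div_period_mem_prime` (`h1`, Coates–Wiles §6 p. 250) and the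
rows `d_K = -43, -67, -163` of Cox's table (12.20) (`singularModuli_classNumberOne_three`,
`j = -960³, -5280³, -640320³`), the other six rows and everything else on pp. 225, 232, 250–251
being proved (`singularModuli_classNumberOne_of_three`,
`CoatesWiles1977_L_one_eq_zero_of_not_isOfFinAddOrder_of_mem_prime_of_singularModuli`).
[cite: CoatesWiles1977, Thm 1 (p. 223)] -/
theorem CoatesWiles1977_L_one_eq_zero_of_not_isOfFinAddOrder_of_mem_prime_of_three
    (h1 : CoatesWiles1977_L_one_div_period_mem_prime)
    (h3 : singularModuli_classNumberOne_three) :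
    CoatesWiles1977_L_one_eq_zero_of_not_isOfFinAddOrder :=
  CoatesWiles1977_L_one_eq_zero_of_not_isOfFinAddOrder_of_mem_prime_of_singularModuli h1
    (singularModuli_classNumberOne_of_three h3)

/-- **bsd.S28 (Mordell–Weil part, maximal-order CM) from the `𝔭`-divisibility fact and the three
remaining singular moduli**: `finite_point_of_j_mem_maximalCMJInvariants_of_L_one_ne_zero`
(`L(E, 1) ≠ 0 ⇒ E(ℚ)` finite, for `j(E) ∈ maximalCMJInvariants`) follows from
`CoatesWiles1977_L_one_div_period_mem_prime` and `singularModuli_classNumberOne_three`, via the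
proved Mordell–Weil reduction; supersedes
`finite_point_of_j_mem_maximalCMJInvariants_of_L_one_ne_zero_of_three`, which also assumed
Deuring's `a_p = π + π̄`. [cite: CoatesWiles1977, Thm 1 (p. 223)] -/
theorem finite_point_of_j_mem_maximalCMJInvariants_of_L_one_ne_zero_of_mem_prime_of_three
    (h1 : CoatesWiles1977_L_one_div_period_mem_prime)
    (h3 : singularModuli_classNumberOne_three) :
    finite_point_of_j_mem_maximalCMJInvariants_of_L_one_ne_zero :=
  finite_point_of_j_mem_maximalCMJInvariants_of_L_one_ne_zero_of_mem_prime_of_singularModuli h1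
    (singularModuli_classNumberOne_of_three h3)

end Literature.NumberTheory.EllipticCurves

end
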